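import Literature.NumberTheory.EllipticCurves.Rank1Residual.FirstLayerCertificates
import Literature.NumberTheory.EllipticCurves.Sha
import Literature.NumberTheory.EllipticCurves.MordellWeil
import Literature.NumberTheory.EllipticCurves.Tamagawa
import Literature.NumberTheory.EllipticCurves.RaySujatha2023.FineSelmerMuLambdaZeroCriterion
import HarnessLib

/-!
# The FINE MORDELL–WEIL CERTIFICATE of a pair `(E, p)`: the per-pair predicates `E(ℚ_p)[p] = 0`,
# `p ∤ ∏ c_ℓ`, `Ш(E/ℚ)[p] = 0`, local indivisibility at `p`, and `Sel₀(ℚ_∞, E[p^∞]) = 0` — definitions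
# only, plus the proved per-pair glue «`Sel₀(ℚ_∞) = 0` ⟹ statement (A) ⟹ Kato divisibility at the pair»

Topic `NumberTheory/EllipticCurves/Rank1Residual` (namespace = path).  Cell `bsd-f3-mu` (D-0131 (3)),
typer seat; transcription of the `-desc` lens's generation-3 vocabulary (MEMO-desc §11 «THE FINE
MORDELL–WEIL (FMW) CERTIFICATE», `HOME/desc/Sketch4.lean` sha16 e481a5934f0b7626, rc 0, BC7 4/4 CLEAN;
refuter `-ref2` g5: the hypothesis set is PRINTED — Ray–Sujatha, Res. Number Theory 9 (2023) Cor. 2.7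
(= Wuthrich, J. Algebraic Geom. 16 (2007), leading-term formula for the fine Selmer group), conclusion
there `μ = λ = 0`; the sharpening «`Sel₀(ℚ_∞, E[p^∞]) = 0`» by exact control is print-assembled
(Greenberg, LNM 1716 §3–4; Lim, Doc. Math. 25 (2020) Thm. 3.3 / Cor. 3.5) and is the cell's claim, filed
Summits-side as an obligation node `SmallImageMu/FineMordellWeilCriteria.lean`, entering the glue below
only as a HYPOTHESIS).  DEFINITIONS with bodies and PREDICATES on pairs; nothing is asserted about any
pair; no new named fact.  Companion of `FirstLayerCertificates.lean` (same topic, same road: a finite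
per-pair certificate ⟹ statement (A) at the pair ⟹ the `μ`-defect `k ≤ 0`).

WHAT (the printed hypothesis set, Ray–Sujatha Cor. 2.7, read at Mordell–Weil rank one).  For `E/ℚ`, `p`
odd with `E[p]` irreducible: `E(ℚ_p)[p] = 0` («`p` is not a local torsion prime», Ray–Sujatha §2 after
Cor. 2.9 and §3), `p ∤ c_ℓ(E)` for every `ℓ` (the Tamagawa hypothesis of Cor. 2.7), `Ш(E/ℚ)[p] = 0`
(the fine Tate–Shafarevich hypothesis `Ж_{p^∞}(E/ℚ) = 0` of Cor. 2.7, equivalent to `Ш(E/ℚ)[p^∞] = 0`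
by Wuthrich's Thm. 2.5 there), `rank E(ℚ) = 1`, and LOCAL INDIVISIBILITY at `p` («some rational point is
not divisible by `p` in `E(ℚ_p)` modulo torsion» — at rank one with `E(ℚ_p)[p] = 0` this is the
hypothesis `Tors_{ℤ_p} D = 0`, `D = coker(E(ℚ) ⊗ ℤ_p → Ê(ℚ_p))`, of Cor. 2.7; Ray–Sujatha §4 before
Lemma 4.7: `Ê(ℚ_p) = ℤ_p ⊕ T`, `φ_E` an isomorphism).  Decidable per pair from the minimal model, a
generator and the record's `Ш[p]` input (MEMO-desc §11.1; table `HOME/desc/d10/FMW-CERT-v2.tsv`,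
sha16 9ca5fa31d4fdb843: 234 certified rank-1 X9 pairs = 24 (5Ns) + 200 (5S4) + 10 (7Ns) of 415).

* `CleanAtP W p` (the `v = p` half of `CleanAt`), `TamagawaCleanAt W p`, `ShaPTorsionFreeAt W p`,
  `LocallyIndivisibleAt W p`, `FineMordellWeilCertAt W p` (the conjunction, with `mordellWeilRank = 1`),
  `FineSelmerTrivialAt W p` (`Sel₀(ℚ_∞, E[p^∞]) = ⊥` for every cyclotomic `κ`) — verbatim the audited
  Sketch4 §1, over the tree's `geomPrimaryTorsion`, `GreenbergSelmer.decomp`, `tamagawaProduct`, `sha`,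
  `mordellWeilRank`, Mathlib's `ℚ_p`-points and `fineSelmerInfty`.
* Glue (proved, per pair): `CleanAt.cleanAtP`; `FineSelmerTrivialAt.conjAAt` (the zero module is a
  fine dual datum, finite over `ℤ_p`) and `.fineMuZeroAt`; and — the criterion «certificate ⟹
  `Sel₀(ℚ_∞) = 0`» entering as the hypothesis `hC` — `katoDivisibilityAt_of_fineMordellWeilCert`:
  Kato's integral divisibility AT THE PAIR through the carriers' engine `ConjAAt.katoDivisibilityAt`
  (T0 proved + S-W⁺ hypothesis `hSW` + F1 + BCS (a) + modularity), with no analytic `μ = 0` input, no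
  class group and no image hypothesis beyond irreducibility.

* §3 (appended): the PRINT ROAD — the hypothesis list of Ray–Sujatha Cor. 2.7 as ONE per-pair predicate
  `RaySujathaCertAt W p` (good reduction at `p`, rank ≤ 1, `p ∤ c_ℓ` for `ℓ ≠ p`, `Ш[p^∞] = 0`,
  `Tors_{ℤ_p} D = 0` — the binders of the tree fact `RaySujatha2023.cor27_…`, p555795), the proved glue
  `fineMuZeroAt_of_raySujathaCert` (print fact + certificate ⟹ pointwise `μ(X₀) = 0`) and the per-pair
  engine `katoDivisibilityAt_of_raySujathaCert` (+ S-W⁺ + F1 + BCS (a) + modularity ⟹ Kato's integral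
  divisibility AT THE PAIR) — a rung conditional on PRINTED facts only (no cell criterion), and
  `ShaPTorsionFreeAt.pow` (`Ш[p] = 0 ⟹ Ш[p^∞] = 0`).

References: [RaySujatha2021] §2 Thm. 2.5, Thm. 2.6, Cor. 2.7, Prop. 2.9, §4 Lemma 4.7 (held text
paper:arxiv-2112.13335 pp. 6–7, 12); [Wuthrich2007JAG] (the leading-term formula, cited through
Ray–Sujatha Thm. 2.6); [DeoRaySujatha2023] §3 (c3); [GreenbergLNM1716] §3–4 (control, local kernels
`ker r_v` of order `c_v^{(p)}`); [CoatesSujatha2005] §3 statement (A); [Kato2004Asterisque] §17.13;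
HOME MEMO-desc.md §11, desc/Sketch4.lean, REF2-LITMAP.md M23 / §3 row desc-FMW.
-/

noncomputable section

open scoped Classical MatrixGroups ModularForm nonZeroDivisors

open CongruenceSubgroup WeierstrassCurve Literature.NumberTheory.EllipticCurves
  Literature.NumberTheory.EllipticCurves.ModularForms Literature.NumberTheory.IwasawaTheory
  IsDedekindDomain NumberField

namespace Literature.NumberTheory.EllipticCurves.Rank1Residual

/-! ### §1 Predicates on a pair `(E, p)` -/

/-- **`CleanAtP W p` — `E(ℚ_p)[p] = 0`** («`p` is not a local torsion prime of `E`»): the `v = p` half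
of `CleanAt` — no non-zero `D_v`-fixed point of `E[p^∞]` killed by `p` for the place `v` of `p`, in the
tree spelling of the `hloc` binder of `DeoRaySujatha2023.thm39_…` (decomposition groups
`GreenbergSelmer.decomp v`).  For good `p ≥ 7` it fails iff `a_p = 1` (Ray–Sujatha §3); for good
ordinary `p ≥ 3` it follows from `a_p ≢ 1 (mod p)`.  A predicate; nothing asserted.
[cite: RaySujatha2021, §2 after Def. 2.8 and Prop. 2.9 («local torsion primes»: `E(ℚ_p)[p] ≠ 0`; arXiv:2112.13335 p. 7)]
[cite: DeoRaySujatha2023, §3 hypothesis (c3) at `v = p` (arXiv:2202.09937 pp. 9–10)] -/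
def CleanAtP (W : WeierstrassCurve ℚ) [W.IsElliptic] (p : ℕ) [Fact p.Prime] : Prop :=
  ∀ v : HeightOneSpectrum (𝓞 ℚ), ((p : ℕ) : 𝓞 ℚ) ∈ v.asIdeal →
    ∀ x : W.geomPrimaryTorsion p, p • x = 0 →
      (∀ d ∈ Literature.NumberTheory.EllipticCurves.GreenbergSelmer.decomp v, d • x = x) → x = 0

/-- A clean pair (`CleanAt`: `E(ℚ_v)[p] = 0` at `v = p` and the bad `v`) is in particular clean at `p`.
[cite: DeoRaySujatha2023, §3 hypothesis (c3)] -/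
theorem CleanAt.cleanAtP {W : WeierstrassCurve ℚ} [W.IsElliptic] {p : ℕ} [Fact p.Prime]
    (h : CleanAt W p) : CleanAtP W p :=
  fun v hv x hx hd => h v (Or.inl hv) x hx hd

/-- **`TamagawaCleanAt W p` — `p ∤ ∏_v c_v`**: the prime `p` does not divide the Tamagawa product of
`W` (the tree's `tamagawaProduct`, a `finprod` of the local indices `c_v = [E(ℚ_v) : E₀(ℚ_v)]`), i.e.
«`p ∤ c_ℓ(E)` for all primes `ℓ ≠ p`» of Ray–Sujatha Cor. 2.7 together with `p ∤ c_p` (automatic at a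
good `p`, `c_p = 1`).  The exact bad-place condition under which the local kernels
`ker(H¹(ℚ_v, E[p^∞]) → H¹(ℚ_{∞,w}, E[p^∞]))`, of order `c_v^{(p)}` (Greenberg), vanish.  A predicate.
[cite: RaySujatha2021, Cor. 2.7, second hypothesis «`p ∤ c_ℓ(E)` for all `ℓ ≠ p`» (arXiv:2112.13335 p. 6)]
[cite: GreenbergLNM1716, §3 (the local kernels `ker r_v` at bad `v ∤ p` have order `c_v^{(p)}`)] -/
def TamagawaCleanAt (W : WeierstrassCurve ℚ) [W.IsElliptic] (p : ℕ) [Fact p.Prime] : Prop :=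
  ¬ (p ∣ W.tamagawaProduct)

/-- **`ShaPTorsionFreeAt W p` — `Ш(E/ℚ)[p] = 0`** on the tree's Tate–Shafarevich group `W.sha ⊆ H¹(ℚ, E)`:
no non-zero class of `Ш` is killed by `p` (equivalently `Ш(E/ℚ)[p^∞] = 0`, equivalently — Wuthrich,
Ray–Sujatha Thm. 2.5 — the fine Tate–Shafarevich group `Ж_{p^∞}(E/ℚ)` vanishes: the third hypothesis of
Cor. 2.7).  Per pair an INPUT of the certificate (for rank-1 X9 records: Matar–Nekovář 2019 Thm. 0.3 +
the Heegner index of record).  A predicate.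
[cite: RaySujatha2021, Thm. 2.5 (Wuthrich: `Ж_{p^∞}(E/ℚ) ≠ 0 ⟺ Ш(E/ℚ)[p^∞] ≠ 0`) and Cor. 2.7, third hypothesis (arXiv:2112.13335 p. 6)]
[cite: MatarNekovar2019, Thm. 0.3 (the per-pair source of `Ш[p] = 0` at analytic rank ≤ 1)] -/
def ShaPTorsionFreeAt (W : WeierstrassCurve ℚ) [W.IsElliptic] (p : ℕ) [Fact p.Prime] : Prop :=
  ∀ c : W.galH1, c ∈ W.sha → p • c = 0 → c = 0

/-- **`LocallyIndivisibleAt W p` — local indivisibility at `p`**: SOME rational point `P ∈ E(ℚ)` is not of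
the form `p·Q + T` with `Q ∈ E(ℚ_p)` and `T ∈ E(ℚ_p)_tors`, i.e. the localisation
`E(ℚ) → E(ℚ_p)/(p·E(ℚ_p) + tors)` is non-zero (Mathlib's points of `W.baseChange ℚ_[p]`,
`Affine.Point.baseChange`).  At Mordell–Weil rank one with `E(ℚ_p)[p] = 0` this is Ray–Sujatha's
hypothesis `Tors_{ℤ_p} D = 0`, `D = coker(E(ℚ) ⊗ ℤ_p → Ê(ℚ_p))`, `Ê(ℚ_p) = lim E(ℚ_p)/pⁿ = ℤ_p ⊕ T`
(§4: `φ_E : ℤ_p → ℤ_p` an isomorphism); for good ordinary non-anomalous odd `p` it is decided on a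
generator `P` by `v_p(x(m·P)) = −2`, `m = #Ẽ(𝔽_p)` (formal group).  A predicate.
[cite: RaySujatha2021, Cor. 2.7, fourth hypothesis `Tors_{ℤ_p}(D) = 0`, with §3 (definition of `D`) and §4 before Lemma 4.7 (`Ê(ℚ_p) = ℤ_p ⊕ T`, `φ_E`) (arXiv:2112.13335 pp. 6, 8, 12)] -/
def LocallyIndivisibleAt (W : WeierstrassCurve ℚ) [W.IsElliptic] (p : ℕ) [Fact p.Prime] : Prop :=
  ∃ P : W.toAffine.Point, ∀ Q T : (W.baseChange ℚ_[p]).toAffine.Point, IsOfFinAddOrder T →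
    Affine.Point.baseChange (W' := W.toAffine) ℚ ℚ_[p] P ≠ p • Q + T

/-- **`FineMordellWeilCertAt W p` — the fine Mordell–Weil certificate at the pair**: `E(ℚ_p)[p] = 0` ∧
`p ∤ ∏ c_v` ∧ `Ш(E/ℚ)[p] = 0` ∧ `rank E(ℚ) = 1` ∧ local indivisibility at `p` — the hypothesis list of
Ray–Sujatha Cor. 2.7 read at Mordell–Weil rank one (their «rank ≤ 1, `p ∤ c_ℓ`, `Ж = 0`, `Tors D = 0`»;
the standing conditions of Thm. 2.6 — fine Selmer `Λ`-cotorsion, `Ж` finite, height pairing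
non-degenerate — hold at rank ≤ 1 under these: Kato, `Ж = 0`, and «`r = 0` and the regulator is `1`
when rank ≤ 1», p. 6).  All five conjuncts are decided per pair from print / record data.  A predicate.
[cite: RaySujatha2021, Cor. 2.7 (hypotheses) with the remark after Thm. 2.6 (arXiv:2112.13335 p. 6)] -/
def FineMordellWeilCertAt (W : WeierstrassCurve ℚ) [W.IsElliptic] (p : ℕ) [Fact p.Prime] : Prop :=
  CleanAtP W p ∧ TamagawaCleanAt W p ∧ ShaPTorsionFreeAt W p ∧ W.mordellWeilRank = 1 ∧
    LocallyIndivisibleAt W p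

/-- **`FineSelmerTrivialAt W p` — `Sel₀(ℚ_∞, E[p^∞]) = 0`**: for every cyclotomic `ℤ_p`-extension datum
`κ` of `ℚ`, the fine Selmer group over its top (the tree's `fineSelmerInfty κ`, Greenberg's strict Selmer
group for `M⁺ = 0`) is the trivial subgroup; then its dual `Y = X₀(E/ℚ_∞)` is `0`, `μ(Y) = λ(Y) = 0`,
and statement (A) holds at the pair (`FineSelmerTrivialAt.conjAAt`).  The sharp form of the conclusion
«`μ = λ = 0`, `R(E/ℚ_∞)` finite» of Ray–Sujatha Cor. 2.7.  A predicate; nothing asserted.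
[cite: RaySujatha2021, Def. 2.1–2.2 (the fine Selmer group over `ℚ_∞`) and Cor. 2.7 (conclusion) (arXiv:2112.13335 pp. 5–6)]
[cite: CoatesSujatha2005, §3 statement (A)] -/
def FineSelmerTrivialAt (W : WeierstrassCurve ℚ) [W.IsElliptic] (p : ℕ) [Fact p.Prime] : Prop :=
  ∀ κ : ZpExtension ℚ p, κ.IsCyclotomic → W.fineSelmerInfty κ = ⊥

/-! ### §2 Per-pair glue (proved; the criterion «certificate ⟹ `Sel₀(ℚ_∞) = 0`» enters as a HYPOTHESIS) -/

section Glue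

variable {W : WeierstrassCurve ℚ} [W.IsElliptic] {p : ℕ} [Fact p.Prime]

/-- **`Sel₀(ℚ_∞, E[p^∞]) = 0` ⟹ statement (A) at the pair** (`ConjAAt`): over every cyclotomic `κ` the
ZERO module (over the generator `1`) is a fine dual datum — `Hom(⊥, ℚ/ℤ) = 0` — and it is finite over
`ℤ_p`.  Verbatim the audited Sketch4 §3. [cite: CoatesSujatha2005, §3 statement (A)]
[cite: RaySujatha2021, Cor. 2.7 («in particular `R(E/ℚ_∞)` has finite cardinality»)] -/
theorem FineSelmerTrivialAt.conjAAt (h : FineSelmerTrivialAt W p) : ConjAAt W p := by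
  intro κ hκ
  have hbot : W.fineSelmerInfty κ = ⊥ := h κ hκ
  have hs : ∀ s : W.fineSelmerInfty κ, s = 0 := fun s => by
    ext1; simpa [hbot] using s.2
  have hf : ∀ f : (W.fineSelmerInfty κ →+ AddCircle (1 : ℚ)), f = 0 := fun f => by
    ext s; rw [hs s, map_zero]; rfl
  let D : W.FineSelmerDualData κ 1 :=
    { X := PUnit, toDual := 0,
      bijective := ⟨fun a b _ => Subsingleton.elim a b, fun f => ⟨PUnit.unit, (hf f).symm⟩⟩,
      toDual_T_smul := fun x s => by simp,
      toDual_C_smul := fun c x s k hk => by simp }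
  refine ⟨1, D, ?_⟩
  show Module.Finite ℤ_[p] (RestrictScalars ℤ_[p] (IwasawaAlgebra p) PUnit)
  haveI : Finite (RestrictScalars ℤ_[p] (IwasawaAlgebra p) PUnit) := inferInstanceAs (Finite PUnit)
  infer_instance

/-- `Sel₀(ℚ_∞, E[p^∞]) = 0` ⟹ pointwise `μ(X₀) = 0` at the pair (`FineMuZeroAt`), through (A) and the
tree theorem T0 `ConjAAt.fineMuZeroAt`. [cite: RaySujatha2021, Cor. 2.7 (conclusion `μ = 0`)]
[cite: Washington1997, §13.2 (`μ = 0` ⟺ finitely generated over `ℤ_p`)] -/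
theorem FineSelmerTrivialAt.fineMuZeroAt (h : FineSelmerTrivialAt W p) : FineMuZeroAt W p :=
  h.conjAAt.fineMuZeroAt

/-- Modus ponens on the criterion: if «`p` odd, `E[p]` irreducible, certificate ⟹ `Sel₀(ℚ_∞) = 0`» (`hC`,
the cell's claim, a hypothesis here) then a certified pair satisfies statement (A).
[cite: RaySujatha2021, Cor. 2.7] [cite: CoatesSujatha2005, §3 statement (A)] -/
theorem conjAAt_of_fineMordellWeilCert
    (hC : ∀ (W : WeierstrassCurve ℚ) [W.IsElliptic] (p : ℕ) [Fact p.Prime], p ≠ 2 →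
      W.HasIrreducibleModPGaloisRep p → FineMordellWeilCertAt W p → FineSelmerTrivialAt W p)
    (hp : p ≠ 2) (hirr : W.HasIrreducibleModPGaloisRep p) (hcert : FineMordellWeilCertAt W p) :
    ConjAAt W p :=
  (hC W p hp hirr hcert).conjAAt

variable [W.IsGloballyMinimal]

/-- **Certificate + the criterion (hypothesis `hC`) ⟹ Kato's integral divisibility AT THE PAIR**
(`KatoDivisibilityAt`), at `p ≥ 5` good ordinary with `E[p]` irreducible, granted BCS (a), modularity,
F1 (Kato's divisibility inputs with the fine quotient) and the bound `k ≤ μ(X₀)` at the pair (`hSW`):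
`hC` gives `Sel₀(ℚ_∞) = 0`, hence statement (A), and the carriers' per-pair engine
`ConjAAt.katoDivisibilityAt` does the rest (T0 is a tree theorem).  The BC5-rung shape of the cell's
crux on its 234 certified rank-1 X9 pairs — no analytic `μ = 0` certificate, no class group, no image
hypothesis beyond irreducibility. [cite: Kato2004Asterisque, Thm. 17.4 (p. 273) and §17.13 (pp. 279–280)]
[cite: RaySujatha2021, Cor. 2.7 (arXiv:2112.13335 p. 6)] -/
theorem katoDivisibilityAt_of_fineMordellWeilCert
    (hC : ∀ (W : WeierstrassCurve ℚ) [W.IsElliptic] (p : ℕ) [Fact p.Prime], p ≠ 2 →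
      W.HasIrreducibleModPGaloisRep p → FineMordellWeilCertAt W p → FineSelmerTrivialAt W p)
    (hBCS : burungale_castella_skinner_charIdeal_eq_padicLFunction)
    (hmodP : nonempty_modularParametrizationData)
    (hfine : Kato2004.exists_divisibilityInputs_fineQuotient) (hp : 5 ≤ p)
    (hgood : W.HasGoodReductionAtPrime p) (hord : ¬ (p : ℤ) ∣ W.frobeniusTrace p)
    (hirr : W.HasIrreducibleModPGaloisRep p) (hSW : MuDefectLeFineMuAt W p)
    (hcert : FineMordellWeilCertAt W p) : KatoDivisibilityAt W p :=
  (conjAAt_of_fineMordellWeilCert hC (by omega) hirr hcert).katoDivisibilityAt hBCS hmodP hfine hp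
    hgood hord hirr hSW

/-- **… and with a unit coefficient of `L_p` (`MuAnZeroAt`) the certified pair has `μ(X) = 0`**
(`MuAlgZeroAt`), by `muAlgZeroAt_of_katoDivisibilityAt_of_muAnZeroAt'` through any newform `f` of `W`.
[cite: GreenbergVatsal2000, p. 2 (2) and Prop. 3.7] [cite: BurungaleCastellaSkinner2025, Thm. 1.1.2 (a) (p. 2 of arXiv:2405.00270v2)] -/
theorem muAlgZeroAt_of_fineMordellWeilCert_of_muAnZeroAt
    (hC : ∀ (W : WeierstrassCurve ℚ) [W.IsElliptic] (p : ℕ) [Fact p.Prime], p ≠ 2 →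
      W.HasIrreducibleModPGaloisRep p → FineMordellWeilCertAt W p → FineSelmerTrivialAt W p)
    (hBCS : burungale_castella_skinner_charIdeal_eq_padicLFunction)
    (hmodP : nonempty_modularParametrizationData)
    (hfine : Kato2004.exists_divisibilityInputs_fineQuotient) (hp : 5 ≤ p)
    (hgood : W.HasGoodReductionAtPrime p) (hord : ¬ (p : ℤ) ∣ W.frobeniusTrace p)
    (hirr : W.HasIrreducibleModPGaloisRep p) (hSW : MuDefectLeFineMuAt W p)
    (hcert : FineMordellWeilCertAt W p) {N : ℕ} [NeZero N] {f : CuspForm (Gamma0 N) 2}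
    (hf : IsNewformOf W f) (hunit : MuAnZeroAt W p) : MuAlgZeroAt W p :=
  muAlgZeroAt_of_katoDivisibilityAt_of_muAnZeroAt' hBCS hp hgood hord hirr hf
    (katoDivisibilityAt_of_fineMordellWeilCert hC hBCS hmodP hfine hp hgood hord hirr hSW hcert) hunit

end Glue

/-! ### §3 The PRINT ROAD: Ray–Sujatha Cor. 2.7 (tree fact `RaySujatha2023.cor27_…`) + its certificate ⟹
`μ(X₀) = 0` at the pair ⟹ (with S-W⁺, F1, BCS (a), modularity) Kato's integral divisibility AT THE PAIR -/

section PrintRoad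

/-- **`RaySujathaCertAt W p` — the Ray–Sujatha certificate at a pair**: the hypothesis list of Cor. 2.7 in
the tree fact's spelling (good-reduction special case): good reduction at `p` ∧ `rank E(ℚ) ≤ 1` ∧
`p ∤ c_ℓ(E)` for every prime `ℓ ≠ p` ∧ `Ш(E/ℚ)[p^∞] = 0` (= `Ж_{p^∞}(E/ℚ) = 0`, Thm. 2.5) ∧
`Tors_{ℤ_p} D_{E,p} = 0` (`WeierstrassCurve.PadicCompletionCokernelTorsionFree`).  Decided per pair from the
minimal model, the Mordell–Weil basis and the record's `Ш` input.  A predicate; nothing asserted.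
[cite: RaySujatha2021, Cor. 2.7 (hypotheses) with Thm. 2.5 (arXiv:2112.13335 §2)] -/
def RaySujathaCertAt (W : WeierstrassCurve ℚ) [W.IsElliptic] (p : ℕ) [Fact p.Prime] : Prop :=
  W.HasGoodReductionAtPrime p ∧ W.mordellWeilRank ≤ 1 ∧
    (∀ (ℓ : ℕ) (_ : Fact ℓ.Prime), ℓ ≠ p → ¬ p ∣ (W.baseChange ℚ_[ℓ]).localTamagawaNumber ℤ_[ℓ]) ∧
    (∀ c : W.galH1, c ∈ W.sha → ∀ n : ℕ, p ^ n • c = 0 → c = 0) ∧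
    W.PadicCompletionCokernelTorsionFree p

variable {W : WeierstrassCurve ℚ} [W.IsElliptic] {p : ℕ} [Fact p.Prime]

/-- `Ш(E/ℚ)[p] = 0 ⟹ Ш(E/ℚ)[p^∞] = 0` (a class killed by `pⁿ⁺¹` has `pⁿ • c ∈ Ш[p]`; induction): the
certificate clause `ShaPTorsionFreeAt` feeds the `Ш[p^∞] = 0` binder of the print fact.
[cite: RaySujatha2021, Thm. 2.5 and Cor. 2.7 (the hypothesis `Ж_{p^∞}(E/ℚ) = 0`)] -/
theorem ShaPTorsionFreeAt.pow (h : ShaPTorsionFreeAt W p) :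
    ∀ c : W.galH1, c ∈ W.sha → ∀ n : ℕ, p ^ n • c = 0 → c = 0 := by
  intro c hc n
  induction n generalizing c with
  | zero => intro h0; simpa using h0
  | succ n ih =>
    intro hn
    have hpn : p • (p ^ n • c) = 0 := by rw [← mul_smul, ← pow_succ']; exact hn
    have hmem : p ^ n • c ∈ W.sha := W.sha.nsmul_mem hc _
    have h1 : p ^ n • c = 0 := h _ hmem hpn
    exact ih c hc h1

/-- **Print fact + certificate ⟹ pointwise `μ(X₀) = 0` at the pair** (`FineMuZeroAt`): Ray–Sujatha
Cor. 2.7 gives `μ(Y) = 0` (indeed `μ = λ = 0`, `Y` finite) for every finitely generated torsion dual fine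
Selmer datum over a cyclotomic `κ` and a topological generator `γ` — exactly the body of `FineMuZeroAt`
(whose extra guard `IsCyclotomicVariable p γ` is not needed). [cite: RaySujatha2021, Cor. 2.7 (arXiv:2112.13335 §2)] -/
theorem fineMuZeroAt_of_raySujathaCert
    (hRS : RaySujatha2023.cor27_fineSelmer_muInvariant_lambdaInvariant_eq_zero) (hp : p ≠ 2)
    (hcert : RaySujathaCertAt W p) : FineMuZeroAt W p := by
  obtain ⟨hgood, hrk, htam, hsha, hD⟩ := hcert
  intro κ γ hκ hγ _hγ' Y hYf hYt
  exact (hRS W p hp hgood hrk htam hsha hD κ γ hκ hγ Y hYf hYt).1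

/-- **Print fact + certificate ⟹ `μ = λ = 0` and finiteness for every finitely generated torsion dual fine
Selmer datum** (the fact's full conclusion at the pair, recorded for consumers).
[cite: RaySujatha2021, Cor. 2.7 (arXiv:2112.13335 §2)] -/
theorem fineSelmerDual_finite_of_raySujathaCert
    (hRS : RaySujatha2023.cor27_fineSelmer_muInvariant_lambdaInvariant_eq_zero) (hp : p ≠ 2)
    (hcert : RaySujathaCertAt W p) :
    ∀ (κ : ZpExtension ℚ p) (γ : Field.absoluteGaloisGroup ℚ), κ.IsCyclotomic → κ.IsTopGenerator γ →
      ∀ Y : W.FineSelmerDualData κ γ,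
        Module.Finite (IwasawaAlgebra p) Y.X → Module.IsTorsion (IwasawaAlgebra p) Y.X →
          muInvariant p Y.X = 0 ∧ lambdaInvariant p Y.X = 0 ∧ Finite Y.X := by
  obtain ⟨hgood, hrk, htam, hsha, hD⟩ := hcert
  exact hRS W p hp hgood hrk htam hsha hD

variable [W.IsGloballyMinimal]

/-- **THE PRINT-ROAD ENGINE: print fact + certificate ⟹ Kato's integral divisibility AT THE PAIR**
(`KatoDivisibilityAt`), at `p ≥ 5` good ordinary with `E[p]` irreducible, granted BCS (a), modularity, F1
and the bound `k ≤ μ(X₀)` at the pair (`hSW`): `μ(X₀) = 0` from Ray–Sujatha, then the fine bridge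
`MuDefectLeFineMuAt.muDefectNonposAt` (the finitely generated torsion fine datum is discharged by
`exists_fineSelmerDualData_finite_isTorsion`) and `MuDefectNonposAt.katoDivisibilityAt`.  No cell
criterion, no class group, no image hypothesis beyond irreducibility: a rung conditional on PRINTED facts
and the per-pair certificate only. [cite: RaySujatha2021, Cor. 2.7 (arXiv:2112.13335 §2)]
[cite: Kato2004Asterisque, Thm. 17.4 (p. 273) and §17.13 (pp. 279–280)] -/
theorem katoDivisibilityAt_of_raySujathaCert
    (hRS : RaySujatha2023.cor27_fineSelmer_muInvariant_lambdaInvariant_eq_zero)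
    (hBCS : burungale_castella_skinner_charIdeal_eq_padicLFunction)
    (hmodP : nonempty_modularParametrizationData)
    (hfine : Kato2004.exists_divisibilityInputs_fineQuotient) (hp : 5 ≤ p)
    (hgood : W.HasGoodReductionAtPrime p) (hord : ¬ (p : ℤ) ∣ W.frobeniusTrace p)
    (hirr : W.HasIrreducibleModPGaloisRep p) (hSW : MuDefectLeFineMuAt W p)
    (hcert : RaySujathaCertAt W p) : KatoDivisibilityAt W p :=
  (hSW.muDefectNonposAt (fineMuZeroAt_of_raySujathaCert hRS (by omega) hcert)
      (exists_fineSelmerDualData_finite_isTorsion hmodP hfine hBCS hp hgood hord hirr)).katoDivisibilityAt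
    hBCS hp hgood hord hirr

/-- **… and with a unit coefficient of `L_p` (`MuAnZeroAt`) the Ray–Sujatha-certified pair has `μ(X) = 0`**
(`MuAlgZeroAt`). [cite: RaySujatha2021, Cor. 2.7] [cite: GreenbergVatsal2000, p. 2 (2) and Prop. 3.7] -/
theorem muAlgZeroAt_of_raySujathaCert_of_muAnZeroAt
    (hRS : RaySujatha2023.cor27_fineSelmer_muInvariant_lambdaInvariant_eq_zero)
    (hBCS : burungale_castella_skinner_charIdeal_eq_padicLFunction)
    (hmodP : nonempty_modularParametrizationData)
    (hfine : Kato2004.exists_divisibilityInputs_fineQuotient) (hp : 5 ≤ p)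
    (hgood : W.HasGoodReductionAtPrime p) (hord : ¬ (p : ℤ) ∣ W.frobeniusTrace p)
    (hirr : W.HasIrreducibleModPGaloisRep p) (hSW : MuDefectLeFineMuAt W p)
    (hcert : RaySujathaCertAt W p) {N : ℕ} [NeZero N] {f : CuspForm (Gamma0 N) 2}
    (hf : IsNewformOf W f) (hunit : MuAnZeroAt W p) : MuAlgZeroAt W p :=
  muAlgZeroAt_of_katoDivisibilityAt_of_muAnZeroAt' hBCS hp hgood hord hirr hf
    (katoDivisibilityAt_of_raySujathaCert hRS hBCS hmodP hfine hp hgood hord hirr hSW hcert) hunit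

end PrintRoad

end Literature.NumberTheory.EllipticCurves.Rank1Residual

end
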